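import Literature.NumberTheory.LFunctions.ZetaZeroReciprocalSumsExplicit
import Literature.NumberTheory.LFunctions.ZetaZeroHarmonicSumBoundLow
import Literature.NumberTheory.LFunctions.ZetaZeroSumsLehmanRefined
import Literature.NumberTheory.LFunctions.ZetaArgBacklundExplicit
import Literature.NumberTheory.LFunctions.ZetaArgHSW
import HarnessLib

/-!
# RH-FREE — `Σ_{0<γ≤T} 1/γ ≤ (1/4π + 1.1·10⁻⁵) log²(T/2π)` for all `T ≥ 4πe`, with NO named fact: Fiori–Kadiri–Swidinsky's Lemma 2.1 fed with the tree's proved Backlund bound («nothing here bears on the truth of RH»)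

Topic `Literature/NumberTheory/LFunctions` (RH literature-typing tranche 1, L4 "explicit zero
statistics", gen 5). THEOREMS only (no definitions, no named facts); every statement below is a
theorem of the tree outright (axioms `propext`, `Classical.choice`, `Quot.sound` and the compiled
evaluations of the tree's certified first `2000` zeros). Nothing here bears on the truth of RH.

Brent–Platt–Trudgian 2022, Lemma 8 (`Σ_{0<γ≤T} 1/γ ≤ log²(T/2π)/(4π)`, `T ≥ 4πe`) is a theorem of
the tree only MODULO the named fact `BrentPlattTrudgian2022_cor1` (`|N(T) − L(T)| ≤ 0.28 log T`, a
part-computational result): `BrentPlattTrudgian2022_cor1.sum_inv_le`. Here the same harmonic sum is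
bounded WITHOUT any named fact, at a relative loss of `1.4·10⁻⁴`, by feeding Fiori–Kadiri–Swidinsky's
Lemma 2.1 (`sum_inv_le_B₁_of_count`, `ZetaZeroReciprocalSumsExplicit.lean` — which needs the
zero-counting bound only on the window `[U, V]`) with the tree's PROVED explicit Backlund bound
`|S(T)| ≤ 0.3083 log T + 3.24` (`T ≥ 30`, `abs_zetaArgS_le_explicit`):

* `abs_count_sub_countMain_le_backlund` — `|N(t) − L(t)| ≤ 0.3083 log t + 3.253` for `t ≥ 30`
  (`L = countMain`; Backlund + the Stirling term `(1.2/π)/t ≤ 0.013`), i.e. the hypothesis of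
  Lemma 2.1 with `(b₁, b₂, b₃) = (0.3083, 0, 3.253)`;
* `sum_inv_window_le_B₁_backlund` — **for `30 ≤ U ≤ V`: `Σ_{U<γ≤V} m(ρ)/γ ≤ B₁(U, V)`** with these
  constants (unconditional instance of FKS Lemma 2.1 / Remark 2.2, where the source offers Rosser's
  or Hasanalizade–Shen–Wong's constants);
* `sum_inv_ordinate_le_unconditional_of_ge_2516` — for `T ≥ 2516`,
  `Σ_{0<γ≤T} m(ρ)/γ ≤ (1/(4π) + 1.1·10⁻⁵) log²(T/2π)` (split at `2516`: the certified zeros give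
  `≤ 2.8405` below, `sum_inv_ordinate_low_le`; Lemma 2.1 above; numerics
  `2.8405 + 0.0046 − (1/4π)·5.99² < 0`);
* `sum_inv_ordinate_le_unconditional` — **for every `T ≥ 4πe`,
  `Σ_{0<γ≤T} m(ρ)/γ ≤ (1/(4π) + 1.1·10⁻⁵) log²(T/2π)`** (below `2516` the tree's unconditional
  `sum_inv_ordinate_le_of_le_heightT0` is sharper).

## References

* A. Fiori, H. Kadiri, J. Swidinsky, J. Math. Anal. Appl. 527 (2023) 127426, Lemma 2.1 and
  Remark 2.2. [FioriKadiriSwidinsky2023]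
* E. Hasanalizade, Q. Shen, P.-J. Wong, J. Number Theory 235 (2022) 219–241, Cor. 1.2 (proved in the
  tree: `zetaZeroCount_hasanalizade_shen_wong_holds`, `ZetaArgHSW.lean`). [HasanalizadeShenWong2022]
* R. P. Brent, D. J. Platt, T. S. Trudgian, J. Number Theory 238 (2022) 740–762, Lemma 8.
  [BrentPlattTrudgian2022]
* R. J. Backlund, Acta Math. 41 (1918) 345–375 (the `S(T)` bound; the tree's explicit form
  `abs_zetaArgS_le_explicit`). [Backlund1918]
-/

noncomputable section

open Complex Filter Set MeasureTheory
open scoped Real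

namespace Literature.NumberTheory.LFunctions

open SchoenfeldBound ZetaNumerics.Mertens

/-! ## The hypothesis of Lemma 2.1 from the tree's Backlund bound -/

/-- **`|N(t) − L(t)| ≤ 0.3083 log t + 3.253` for `t ≥ 30`** (`L(t) = (t/2π) log(t/2πe) + 7/8`): the
tree's proved `|S(t)| ≤ 0.3083 log t + 3.24` (`abs_zetaArgS_le_explicit`) and
`|N − L − S| ≤ (1.2/π)/t ≤ 0.013` (`abs_count_sub_countMain_sub_zetaArgS_le`). This is the
hypothesis of FKS Lemma 2.1 with `(b₁, b₂, b₃) = (0.3083, 0, 3.253)` on `[30, ∞)`.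
[cite: FioriKadiriSwidinsky2023, Lemma 2.1 and Remark 2.2] -/
theorem abs_count_sub_countMain_le_backlund {t : ℝ} (ht : 30 ≤ t) :
    |(zetaZeroCount t : ℝ) - countMain t| ≤ FKS2023.countErr 0.3083 0 3.253 t := by
  have hπ3 : 3.14 < π := Real.pi_gt_d2
  have h1 := abs_count_sub_countMain_sub_zetaArgS_le (by linarith : (2 : ℝ) ≤ t)
  have h2 := abs_zetaArgS_le_explicit ht
  have h3 : (1.2 / π) / t ≤ 0.013 := by
    rw [div_div, div_le_iff₀ (by positivity)]
    nlinarith [mul_le_mul (show (3.14 : ℝ) ≤ π from hπ3.le) ht (by norm_num) (by linarith)]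
  have h4 := abs_sub_abs_le_abs_sub ((zetaZeroCount t : ℝ) - countMain t) (zetaArgS t)
  unfold FKS2023.countErr
  linarith

/-- **Unconditional instance of FKS Lemma 2.1**: for `30 ≤ U ≤ V`,
`Σ_{U<γ≤V} m(ρ)/γ ≤ B₁(U,V)` with `(b₁, b₂, b₃) = (0.3083, 0, 3.253)`, i.e.
`(1/2π + 0.3083 log U/(U log U log(U/2π))) log(V/U) log(√(VU)/2π) + 2(0.3083 log U + 3.253)/U`.
[cite: FioriKadiriSwidinsky2023, Lemma 2.1 and Remark 2.2] -/
theorem sum_inv_window_le_B₁_backlund {U V : ℝ} (hU : 30 ≤ U) (hUV : U ≤ V) :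
    ∑ ρ ∈ zerosBetween U V, (riemannZetaZeroOrder ρ : ℝ) * (1 / ρ.im) ≤
      FKS2023.B₁ 0.3083 0 3.253 U V := by
  have hπ : π < 3.15 := Real.pi_lt_d2
  exact sum_inv_le_B₁_of_count (by norm_num) le_rfl (by linarith) hUV
    fun t ht ↦ abs_count_sub_countMain_le_backlund (hU.trans ht.1)

/-! ## The harmonic sum over all ordinates up to `T`, unconditionally -/

/-- Kernel numerics at `2516`: `5.99 ≤ log(2516/2π)`, `log 2516 ≤ 8`. [folklore] -/
private theorem numerics_2516 :
    5.99 ≤ Real.log (2516 / (2 * π)) ∧ Real.log 2516 ≤ 8 := by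
  have hπ3 : 3 < π := Real.pi_gt_three
  have hπ4 : π < 3.1416 := by linarith [Real.pi_lt_d6]
  have he1 : Real.exp 1 < 2.7182818286 := Real.exp_one_lt_d9
  have he2 : 2.7182818283 < Real.exp 1 := Real.exp_one_gt_d9
  have h2π : (0 : ℝ) < 2 * π := by positivity
  constructor
  · rw [Real.le_log_iff_exp_le (div_pos (by norm_num) h2π), le_div_iff₀ h2π]
    have h6 : Real.exp 6 = Real.exp 1 ^ 6 := by
      rw [← Real.exp_nat_mul]; norm_num
    have h6b : Real.exp 6 < 403.43 := by
      rw [h6]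
      have : Real.exp 1 ^ 6 < 2.7182818286 ^ 6 := by gcongr
      linarith [show (2.7182818286 : ℝ) ^ 6 < 403.43 by norm_num]
    have hsplit : Real.exp 5.99 * Real.exp 0.01 = Real.exp 6 := by
      rw [← Real.exp_add]; norm_num
    have h001 : (1.01 : ℝ) ≤ Real.exp 0.01 := by
      have := Real.add_one_le_exp (0.01 : ℝ); linarith
    have hpos : 0 < Real.exp 5.99 := Real.exp_pos _
    nlinarith
  · rw [Real.log_le_iff_le_exp (by norm_num)]
    have h8 : Real.exp 8 = Real.exp 1 ^ 8 := by
      rw [← Real.exp_nat_mul]; norm_num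
    rw [h8]
    have : (2.7182818283 : ℝ) ^ 8 ≤ Real.exp 1 ^ 8 := by gcongr
    linarith [show (2516 : ℝ) ≤ 2.7182818283 ^ 8 by norm_num]

/-- **For `T ≥ 2516`: `Σ_{0<γ≤T} m(ρ)/γ ≤ (1/(4π) + 1.1·10⁻⁵) log²(T/2π)`, unconditionally and
without named facts** — the certified zeros below `2516` (`Σ ≤ 2.8405`), FKS Lemma 2.1 with the
Backlund constants on `(2516, T]`, and `2.8405 + 2(0.3083·8 + 3.253)/2516 < (1/(4π))·5.99²`.
[cite: FioriKadiriSwidinsky2023, Lemma 2.1] [cite: BrentPlattTrudgian2022, Lemma 8] -/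
theorem sum_inv_ordinate_le_unconditional_of_ge_2516 {T : ℝ} (hT : 2516 ≤ T) :
    ∑ ρ ∈ zerosBetween 0 T, (riemannZetaZeroOrder ρ : ℝ) * (1 / ρ.im) ≤
      (1 / (4 * π) + 1.1e-5) * Real.log (T / (2 * π)) ^ 2 := by
  have hπ3 : 3.141592 < π := Real.pi_gt_d6
  have hπ4 : π < 3.141593 := Real.pi_lt_d6
  have hπ0 : 0 < π := Real.pi_pos
  have h2π : (0 : ℝ) < 2 * π := by positivity
  have hT0 : 0 < T := by linarith
  obtain ⟨hLU, hℓ⟩ := numerics_2516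
  have hH : ((heightT0 : ℕ) : ℝ) = 2516 := by norm_num [heightT0]
  -- split at 2516
  rw [SoundTest.sum_zerosBetween_split le_rfl (by norm_num : (0 : ℝ) ≤ 2516) hT
    (fun ρ ↦ (riemannZetaZeroOrder ρ : ℝ) * (1 / ρ.im))]
  have hlow := sum_inv_ordinate_low_le
  rw [hH] at hlow
  have hwin := sum_inv_window_le_B₁_backlund (by norm_num : (30 : ℝ) ≤ 2516) hT
  -- the pieces of `B₁(2516, T)`
  set LT : ℝ := Real.log (T / (2 * π)) with hLT
  set LU : ℝ := Real.log (2516 / (2 * π)) with hLUdef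
  set ℓ : ℝ := Real.log 2516 with hℓdef
  have hℓ0 : 0 < ℓ := by rw [hℓdef]; exact Real.log_pos (by norm_num)
  have hLU0 : 0 < LU := by linarith
  have hLT_ge : LU ≤ LT := by
    rw [hLT, hLUdef]; exact Real.log_le_log (by positivity) (by gcongr)
  -- main term identity
  have hmain : Real.log (T / 2516) * Real.log (Real.sqrt (T * 2516) / (2 * π)) =
      (LT ^ 2 - LU ^ 2) / 2 := by
    have eVU : Real.log (T / 2516) = LT - LU := by
      rw [hLT, hLUdef, Real.log_div hT0.ne' (by norm_num), Real.log_div hT0.ne' h2π.ne',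
        Real.log_div (by norm_num) h2π.ne']
      ring
    have eS : Real.log (Real.sqrt (T * 2516) / (2 * π)) = (LT + LU) / 2 := by
      rw [hLT, hLUdef, Real.log_div (Real.sqrt_pos.2 (by positivity)).ne' h2π.ne',
        Real.log_sqrt (by positivity), Real.log_mul hT0.ne' (by norm_num),
        Real.log_div hT0.ne' h2π.ne', Real.log_div (by norm_num) h2π.ne']
      ring
    rw [eVU, eS]; ring
  have hM0 : 0 ≤ (LT ^ 2 - LU ^ 2) / 2 := by nlinarith
  -- the coefficient: 1/(2π) + 0.3083 ℓ/(2516 ℓ LU) ≤ 0.15917546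
  have hc : (0.3083 * ℓ + 0) / (2516 * ℓ * LU) ≤ 2.046e-5 := by
    have e : (0.3083 * ℓ + 0) / (2516 * ℓ * LU) = 0.3083 / (2516 * LU) := by
      rw [add_zero]
      field_simp
    rw [e, div_le_iff₀ (by positivity)]
    nlinarith
  have hinv2π : 1 / (2 * π) ≤ 0.159155 := by
    rw [div_le_iff₀ h2π]; nlinarith
  have hprod : (1 / (2 * π) + (0.3083 * ℓ + 0) / (2516 * ℓ * LU)) *
      (Real.log (T / 2516) * Real.log (Real.sqrt (T * 2516) / (2 * π))) ≤
      0.15917546 * ((LT ^ 2 - LU ^ 2) / 2) := by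
    rw [hmain]
    exact mul_le_mul_of_nonneg_right (by linarith) hM0
  -- the tail term 2R(2516)/2516 ≤ 0.004547
  have hR : 2 * FKS2023.countErr 0.3083 0 3.253 2516 / 2516 ≤ 0.004547 := by
    unfold FKS2023.countErr
    rw [div_le_iff₀ (by norm_num)]
    have : Real.log (Real.log (2516 : ℝ)) = Real.log ℓ := by rw [hℓdef]
    nlinarith
  have hB : FKS2023.B₁ 0.3083 0 3.253 2516 T ≤ 0.15917546 * ((LT ^ 2 - LU ^ 2) / 2) + 0.004547 := by
    unfold FKS2023.B₁
    linarith
  -- the right-hand side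
  have hinv4π : 0.0795773 ≤ 1 / (4 * π) := by
    rw [le_div_iff₀ (by positivity)]; nlinarith
  have hrhs : (0.0795773 + 1.1e-5) * LT ^ 2 ≤ (1 / (4 * π) + 1.1e-5) * LT ^ 2 :=
    mul_le_mul_of_nonneg_right (by linarith) (sq_nonneg _)
  have hLU2 : 35.8801 ≤ LU ^ 2 := by nlinarith
  nlinarith [hlow, hwin, hB, hrhs, hLU2, sq_nonneg LT]

/-- **For every `T ≥ 4πe`: `Σ_{0<γ≤T} m(ρ)/γ ≤ (1/(4π) + 1.1·10⁻⁵) log²(T/2π)`**, a theorem of the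
tree with no named-fact hypothesis (Brent–Platt–Trudgian's Lemma 8 has `1/(4π)` exactly, modulo
their Corollary 1). Below `2516`: the tree's unconditional `sum_inv_ordinate_le_of_le_heightT0`;
above: `sum_inv_ordinate_le_unconditional_of_ge_2516`.
[cite: BrentPlattTrudgian2022, Lemma 8] [cite: FioriKadiriSwidinsky2023, Lemma 2.1] -/
theorem sum_inv_ordinate_le_unconditional {T : ℝ} (hT : 4 * π * Real.exp 1 ≤ T) :
    ∑ ρ ∈ zerosBetween 0 T, (riemannZetaZeroOrder ρ : ℝ) * (1 / ρ.im) ≤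
      (1 / (4 * π) + 1.1e-5) * Real.log (T / (2 * π)) ^ 2 := by
  have hH : ((heightT0 : ℕ) : ℝ) = 2516 := by norm_num [heightT0]
  rcases le_or_gt T (heightT0 : ℝ) with hle | hgt
  · have h := sum_inv_ordinate_le_of_le_heightT0 hT hle
    have e : ∑ ρ ∈ zerosBetween 0 T, (riemannZetaZeroOrder ρ : ℝ) / ρ.im =
        ∑ ρ ∈ zerosBetween 0 T, (riemannZetaZeroOrder ρ : ℝ) * (1 / ρ.im) :=
      Finset.sum_congr rfl fun ρ _ ↦ by ring
    rw [e] at h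
    have hπ0 : 0 < π := Real.pi_pos
    have hsq : 0 ≤ Real.log (T / (2 * π)) ^ 2 := sq_nonneg _
    have : Real.log (T / (2 * π)) ^ 2 / (4 * π) ≤ (1 / (4 * π) + 1.1e-5) * Real.log (T / (2 * π)) ^ 2 := by
      rw [div_eq_mul_one_div, mul_comm]
      exact mul_le_mul_of_nonneg_right (by norm_num) hsq
    exact h.trans this
  · rw [hH] at hgt
    exact sum_inv_ordinate_le_unconditional_of_ge_2516 hgt.le

/-- The same in Brent–Platt–Trudgian's normalisation: for `T ≥ 4πe`,
`Σ_{0<γ≤T} m(ρ)/γ ≤ 1.00014 · log²(T/2π)/(4π)`.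
[cite: BrentPlattTrudgian2022, Lemma 8] [cite: FioriKadiriSwidinsky2023, Lemma 2.1] -/
theorem sum_inv_ordinate_le_unconditional' {T : ℝ} (hT : 4 * π * Real.exp 1 ≤ T) :
    ∑ ρ ∈ zerosBetween 0 T, (riemannZetaZeroOrder ρ : ℝ) / ρ.im ≤
      1.00014 * (Real.log (T / (2 * π)) ^ 2 / (4 * π)) := by
  have hπ4 : π < 3.141593 := Real.pi_lt_d6
  have hπ0 : 0 < π := Real.pi_pos
  have h := sum_inv_ordinate_le_unconditional hT
  have e : ∑ ρ ∈ zerosBetween 0 T, (riemannZetaZeroOrder ρ : ℝ) / ρ.im =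
      ∑ ρ ∈ zerosBetween 0 T, (riemannZetaZeroOrder ρ : ℝ) * (1 / ρ.im) :=
    Finset.sum_congr rfl fun ρ _ ↦ by ring
  rw [e]
  refine h.trans ?_
  have hsq : 0 ≤ Real.log (T / (2 * π)) ^ 2 := sq_nonneg _
  have hc : (1 / (4 * π) + 1.1e-5) ≤ 1.00014 * (1 / (4 * π)) := by
    rw [show 1.00014 * (1 / (4 * π)) = 1 / (4 * π) + 0.00014 / (4 * π) by ring]
    have : (1.1e-5 : ℝ) ≤ 0.00014 / (4 * π) := by
      rw [le_div_iff₀ (by positivity)]; nlinarith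
    linarith
  calc (1 / (4 * π) + 1.1e-5) * Real.log (T / (2 * π)) ^ 2
      ≤ 1.00014 * (1 / (4 * π)) * Real.log (T / (2 * π)) ^ 2 := mul_le_mul_of_nonneg_right hc hsq
    _ = 1.00014 * (Real.log (T / (2 * π)) ^ 2 / (4 * π)) := by ring

/-! ## The hypothesis of Lemma 2.1 on all of `[2, ∞)` -/

/-- `γ₃ > 30` (0-indexed; the fourth zero `30.42…` lies above `30`): compiled check on the certified
bracket. Declared to the gate as `computational` (`native_decide`). [cite: OdlyzkoTeRiele1985, §4.2 p. 151] -/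
theorem SchoenfeldBound.ordinate_three_check : 30 * 2 ^ 240 < ordinate 3 := by
  native_decide

/-- `30 < γ₃`. [cite: OdlyzkoTeRiele1985, §4.2 p. 151] -/
theorem SchoenfeldBound.thirty_lt_lowOrdinate_three : 30 < lowOrdinate 3 := by
  have h2p : (0 : ℝ) < 2 ^ 240 := by positivity
  have hb : (30 : ℝ) < t₁ 3 := by
    unfold t₁; rw [lt_div_iff₀ h2p]; exact_mod_cast SchoenfeldBound.ordinate_three_check
  exact hb.trans_le (lowOrdinate_spec (by norm_num)).1.1

/-- **`N(T) ≤ 3` for `T ≤ 30`**: the zeros below `2516` are the certified simple zeros `½ + iγ_j`,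
and `γ₃ > 30`. [cite: OdlyzkoTeRiele1985, §4.2 p. 151] -/
theorem zetaZeroCount_le_three {T : ℝ} (hT : T ≤ 30) : (zetaZeroCount T : ℝ) ≤ 3 := by
  classical
  rw [zetaZeroCount_eq_sum]
  set F : ℕ → ℂ := fun j ↦ (1 / 2 + lowOrdinate j * I : ℂ) with hF
  have hsub : (zetaZeroBox_finite 0 T).toFinset ⊆ (Finset.range 3).image F := by
    intro ρ hρ
    rw [Set.Finite.mem_toFinset] at hρ
    obtain ⟨hz, h0, h1, him, hT'⟩ := hρ
    obtain ⟨j, hj, rfl⟩ := zero_eq_of_im_le_heightT0 hz h0 h1 him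
      (hT'.trans (hT.trans (by unfold heightT0; norm_num)))
    refine Finset.mem_image.2 ⟨j, Finset.mem_range.2 ?_, rfl⟩
    by_contra hj3
    have hle : lowOrdinate 3 ≤ lowOrdinate j := by
      rcases (not_lt.1 hj3).eq_or_lt with h | h
      · rw [h]
      · exact (lowOrdinate_strictMono h hj).le
    have : (1 / 2 + lowOrdinate j * I : ℂ).im = lowOrdinate j := by simp
    rw [this] at hT'
    linarith [SchoenfeldBound.thirty_lt_lowOrdinate_three]
  have hinj : Set.InjOn F (Finset.range 3 : Finset ℕ) := by
    intro a ha b hb hab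
    have ha' : a < 2000 := by have := Finset.mem_range.1 ha; omega
    have hb' : b < 2000 := by have := Finset.mem_range.1 hb; omega
    have him : lowOrdinate a = lowOrdinate b := by
      have := congrArg Complex.im hab; simpa [hF] using this
    exact lowOrdinate_injOn (Finset.mem_coe.2 (Finset.mem_range.2 ha'))
      (Finset.mem_coe.2 (Finset.mem_range.2 hb')) him
  have hnonneg : ∀ ρ ∈ (Finset.range 3).image F, (0 : ℝ) ≤ riemannZetaZeroOrder ρ := by
    intro ρ hρ
    obtain ⟨j, hj, rfl⟩ := Finset.mem_image.1 hρ
    have hj' : j < 2000 := by have := Finset.mem_range.1 hj; omega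
    exact riemannZetaZeroOrder_nonneg_of_zero (lowOrdinate_spec hj').2
  calc ∑ ρ ∈ (zetaZeroBox_finite 0 T).toFinset, (riemannZetaZeroOrder ρ : ℝ)
      ≤ ∑ ρ ∈ (Finset.range 3).image F, (riemannZetaZeroOrder ρ : ℝ) :=
        Finset.sum_le_sum_of_subset_of_nonneg hsub fun ρ hρ _ ↦ hnonneg ρ hρ
    _ = ∑ j ∈ Finset.range 3, (riemannZetaZeroOrder (F j) : ℝ) := Finset.sum_image hinj
    _ = 3 := by
        rw [Finset.sum_congr rfl fun j hj ↦ by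
          rw [hF, riemannZetaZeroOrder_lowOrdinate (by have := Finset.mem_range.1 hj; omega)]]
        simp

/-- `L(t) = (t/2π) log(t/2π) − t/2π + 7/8 ≥ −1/8` (`t > 0`; `u log u − u ≥ −1`).
[cite: Titchmarsh1986, Thm. 9.4] -/
theorem SchoenfeldBound.neg_eighth_le_countMain {t : ℝ} (ht : 0 < t) : -(1 / 8) ≤ countMain t := by
  unfold countMain
  set u := t / (2 * π) with hu
  have hu0 : 0 < u := by rw [hu]; positivity
  have h := Real.one_sub_inv_le_log_of_pos hu0
  have : u - 1 ≤ u * Real.log u := by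
    have := mul_le_mul_of_nonneg_left h hu0.le
    rwa [mul_sub, mul_one, mul_inv_cancel₀ hu0.ne'] at this
  linarith

/-- `L(t) ≤ 7/8` for `0 < t ≤ 17` (`t/2π ≤ e`). [cite: Titchmarsh1986, Thm. 9.4] -/
theorem SchoenfeldBound.countMain_le_of_le_seventeen {t : ℝ} (ht : 0 < t) (h17 : t ≤ 17) :
    countMain t ≤ 7 / 8 := by
  have hπ3 : 3.14 < π := Real.pi_gt_d2
  have he : 2.7182818283 < Real.exp 1 := Real.exp_one_gt_d9
  unfold countMain
  set u := t / (2 * π) with hu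
  have hu0 : 0 < u := by rw [hu]; positivity
  have hue : u ≤ Real.exp 1 := by
    rw [hu, div_le_iff₀ (by positivity)]; nlinarith
  have hlog : Real.log u ≤ 1 := by
    have := Real.log_le_log hu0 hue
    rwa [Real.log_exp] at this
  nlinarith

/-- `L(t) ≤ 3.7` for `0 < t ≤ 30` (`u = t/2π < 4.78`, `log u ≤ log 4 + u/4 − 1`).
[cite: Titchmarsh1986, Thm. 9.4] -/
theorem SchoenfeldBound.countMain_le_of_le_thirty {t : ℝ} (ht : 0 < t) (h30 : t ≤ 30) :
    countMain t ≤ 3.7 := by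
  have hπ3 : 3.14 < π := Real.pi_gt_d2
  have hl2 : Real.log 2 < 0.6931471808 := Real.log_two_lt_d9
  unfold countMain
  set u := t / (2 * π) with hu
  have hu0 : 0 < u := by rw [hu]; positivity
  have hu5 : u ≤ 4.78 := by
    rw [hu, div_le_iff₀ (by positivity)]; nlinarith
  have hlog4 : Real.log 4 < 1.3863 := by
    rw [show (4 : ℝ) = 2 ^ 2 by norm_num, Real.log_pow]; push_cast; linarith
  have hlogu : Real.log u ≤ Real.log 4 + (u / 4 - 1) := by
    have h := Real.log_le_sub_one_of_pos (show 0 < u / 4 by positivity)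
    rw [Real.log_div hu0.ne' (by norm_num)] at h
    linarith
  have : u * Real.log u ≤ u * (0.3863 + u / 4) :=
    mul_le_mul_of_nonneg_left (by linarith) hu0.le
  nlinarith

/-- **`|N(t) − L(t)| ≤ 0.3083 log t + 3.253` for all `t ≥ 2`** — the hypothesis of FKS Lemma 2.1 /
Prop. 3.6 with `(b₁, b₂, b₃) = (0.3083, 0, 3.253)` on the whole printed range `t ≥ 2`, with NO named
fact: for `t ≥ 30` the Backlund bound (`abs_count_sub_countMain_le_backlund`); for `2 ≤ t < 30` the
certified zeros (`N(t) ≤ 3`) and `−1/8 ≤ L(t) ≤ 3.7` (`≤ 7/8` for `t ≤ 17`).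
[cite: FioriKadiriSwidinsky2023, Lemma 2.1 and Remark 2.2] -/
theorem abs_count_sub_countMain_le_backlund_two {t : ℝ} (ht : 2 ≤ t) :
    |(zetaZeroCount t : ℝ) - countMain t| ≤ FKS2023.countErr 0.3083 0 3.253 t := by
  rcases le_or_gt 30 t with h30 | h30
  · exact abs_count_sub_countMain_le_backlund h30
  have ht0 : 0 < t := by linarith
  have hlog0 : 0 ≤ Real.log t := Real.log_nonneg (by linarith)
  have hN0 : (0 : ℝ) ≤ zetaZeroCount t := Nat.cast_nonneg _
  have hN3 := zetaZeroCount_le_three h30.le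
  have hL1 := SchoenfeldBound.neg_eighth_le_countMain ht0
  have hL3 := SchoenfeldBound.countMain_le_of_le_thirty ht0 h30.le
  unfold FKS2023.countErr
  rw [abs_le]
  rcases le_or_gt t 17 with h17 | h17
  · have hL2 := SchoenfeldBound.countMain_le_of_le_seventeen ht0 h17
    constructor <;> nlinarith
  · -- `log t ≥ 2` for `t > 17 > e²`
    have he : Real.exp 1 < 2.7182818286 := Real.exp_one_lt_d9
    have hlog2 : 2 ≤ Real.log t := by
      rw [Real.le_log_iff_exp_le ht0, show (2 : ℝ) = 1 + 1 by norm_num, Real.exp_add]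
      nlinarith [Real.exp_pos 1]
    constructor <;> nlinarith

/-! ## The hypothesis of Lemma 2.1 with Hasanalizade–Shen–Wong's constants (Remark 2.2), from the
tree's PROVED `zetaZeroCount_hasanalizade_shen_wong_holds` -/

/-- **`|N(t) − L(t)| ≤ 0.1038 log t + 0.2573 log log t + 10.2425` for `t ≥ e`**: the tree's proved
Hasanalizade–Shen–Wong bound `|N(T) − (T/2π)log(T/2πe)| ≤ 0.1038 log T + 0.2573 log log T + 9.3675`
(`zetaZeroCount_hasanalizade_shen_wong_holds`) and `L(t) = (t/2π)log(t/2πe) + 7/8` (FKS Remark 2.2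
quotes HSW's constants for the hypothesis of Lemma 2.1, whose main term carries the `7/8`; the honest
`b₃` is therefore `9.3675 + 7/8`). [cite: FioriKadiriSwidinsky2023, Lemma 2.1 and Remark 2.2]
[cite: HasanalizadeShenWong2022, Corollary 1.2] -/
theorem abs_count_sub_countMain_le_hsw {t : ℝ} (ht : Real.exp 1 ≤ t) :
    |(zetaZeroCount t : ℝ) - countMain t| ≤ FKS2023.countErr 0.1038 0.2573 10.2425 t := by
  have h := zetaZeroCount_hasanalizade_shen_wong_holds t ht
  have ht0 : 0 < t := lt_of_lt_of_le (Real.exp_pos 1) ht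
  have e : t / (2 * π) * Real.log (t / (2 * π * Real.exp 1)) = countMain t - 7 / 8 := by
    unfold countMain
    rw [show t / (2 * π * Real.exp 1) = t / (2 * π) / Real.exp 1 by ring,
      Real.log_div (by positivity) (Real.exp_pos 1).ne', Real.log_exp]
    ring
  rw [e] at h
  have h4 := abs_sub_le ((zetaZeroCount t : ℝ) - countMain t) ((zetaZeroCount t : ℝ) - (countMain t - 7 / 8)) 0
  rw [sub_zero, sub_zero, show (zetaZeroCount t : ℝ) - countMain t - ((zetaZeroCount t : ℝ) -
    (countMain t - 7 / 8)) = -(7 / 8) by ring, abs_neg, abs_of_pos (by norm_num : (0:ℝ) < 7 / 8)] at h4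
  unfold FKS2023.countErr
  linarith

/-- **The same on the whole printed range `t ≥ 2`** (for `2 ≤ t < e`: `N(t) ≤ 3`, `−1/8 ≤ L(t) ≤ 7/8`,
and `log log t ≥ 1 − 1/log 2`). [cite: FioriKadiriSwidinsky2023, Lemma 2.1 and Remark 2.2]
[cite: HasanalizadeShenWong2022, Corollary 1.2] -/
theorem abs_count_sub_countMain_le_hsw_two {t : ℝ} (ht : 2 ≤ t) :
    |(zetaZeroCount t : ℝ) - countMain t| ≤ FKS2023.countErr 0.1038 0.2573 10.2425 t := by
  rcases le_or_gt (Real.exp 1) t with he | he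
  · exact abs_count_sub_countMain_le_hsw he
  have he3 : Real.exp 1 < 2.7182818286 := Real.exp_one_lt_d9
  have ht0 : 0 < t := by linarith
  have ht17 : t ≤ 17 := by linarith
  have hN0 : (0 : ℝ) ≤ zetaZeroCount t := Nat.cast_nonneg _
  have hN3 := zetaZeroCount_le_three (show t ≤ 30 by linarith)
  have hL1 := SchoenfeldBound.neg_eighth_le_countMain ht0
  have hL2 := SchoenfeldBound.countMain_le_of_le_seventeen ht0 ht17
  have hl2 : 0.6931471803 < Real.log 2 := Real.log_two_gt_d9
  have hlog : Real.log 2 ≤ Real.log t := Real.log_le_log (by norm_num) ht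
  have hlog0 : 0 < Real.log t := by linarith
  -- `log log t ≥ 1 − 1/log t ≥ 1 − 1/log 2 > −0.45`
  have hll : -0.45 ≤ Real.log (Real.log t) := by
    have h1 := Real.one_sub_inv_le_log_of_pos hlog0
    have h2 : (Real.log t)⁻¹ ≤ (Real.log 2)⁻¹ := by
      rw [inv_le_inv₀ hlog0 (by linarith)]; exact hlog
    have h3 : (Real.log 2)⁻¹ ≤ 1.45 := by
      rw [inv_le_comm₀ (by linarith) (by norm_num)]; linarith
    linarith
  unfold FKS2023.countErr
  rw [abs_le]
  constructor <;> nlinarith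

/-- **FKS Lemma 2.1 with Hasanalizade–Shen–Wong's constants, fact-free**: for `2π < U ≤ V`,
`Σ_{U<γ≤V} m(ρ)/γ ≤ B₁(0.1038, 0.2573, 10.2425; U, V)`.
[cite: FioriKadiriSwidinsky2023, Lemma 2.1 and Remark 2.2] [cite: HasanalizadeShenWong2022, Corollary 1.2] -/
theorem sum_inv_window_le_B₁_hsw {U V : ℝ} (hU : 2 * π < U) (hUV : U ≤ V) :
    ∑ ρ ∈ zerosBetween U V, (riemannZetaZeroOrder ρ : ℝ) * (1 / ρ.im) ≤
      FKS2023.B₁ 0.1038 0.2573 10.2425 U V := by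
  have hπ : 3.14 < π := Real.pi_gt_d2
  exact sum_inv_le_B₁_of_count (by norm_num) (by norm_num) hU hUV
    fun t ht ↦ abs_count_sub_countMain_le_hsw_two (by linarith [ht.1])

end Literature.NumberTheory.LFunctions

end
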